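import Mathlib
import Literature.MathematicalPhysics.QuantumLattice.WilsonDiracAP
import Literature.MathematicalPhysics.QuantumLattice.SpectralLocalizer
import Summits.QuantumFields.QCD.Theorems.QuarksAsStableActionWilsonQuarkStabilityTangentLinearKernel

/-!
# The real closed form of the block-Hessian entries
(helper for crux stmt-QuantumFields-9734, line `Sketch`, stub `stub_blockClosedForm`)

What.  In the momentum form of the one-loop block Hessian (landed as `stub_blockHessianFormula`, mass `0`),
`H_s(μ,ν) = ½[μ=ν] Σ_σ 4(sin² P_μ − M_W(P) cos P_μ)/h(P) + ½ Re Σ_σ tr (S(P) V_ν(P+q,q) S(P+q) V_μ(P,q))`,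
`P = θ + πσ`, `q = πs`, with the free propagator `S(P) = (M_W(P)·1 − iΣ_κ sin P_κ γ_κ)/h(P)`
(`M_W = Σ_κ(1 − cos P_κ)`, `h = M_W² + Σ sin²`) and the `r = 1` Wilson vertices
`V_μ(P,q) = −½ e^{iP_μ} i (1 − γ_μ) − ½ e^{−i(P_μ+q_μ)} (−i)(1 + γ_μ)`.  For ACTIVE directions
(`s_μ = s_ν = 1`, so `q_μ = q_ν = π`) this is a rational function of `C_κ = cos θ_κ`: with `sg_σ(κ) = (−1)^{σ_κ}`,
`A(σ) = Σ_κ (1 − sg_σ(κ) C_κ)`, `S2_κ = 1 − C_κ²`, `hh(σ) = A(σ)² + Σ S2`, `W(s) = Σ_κ sg_s(κ) S2_κ`: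
`H_s(μ,ν) = [μ=ν] Σ_σ 2(S2_μ − A(σ) sg_σ(μ)C_μ)/hh(σ) + Σ_σ 2 T(σ,s,μ,ν)/(hh(σ) hh(σ+s))` with the explicit
quartic `T` of the statement (`stub_blockClosedForm`).

How.  (1) Spin traces from the Clifford relations: `tr γ_aγ_b = 4δ_{ab}` (imported), `tr γ_aγ_bγ_c = 0` (it is
`γ₅`-odd), `tr γ_aγ_bγ_cγ_d = 4(δ_{ab}δ_{cd} − δ_{ac}δ_{bd} + δ_{ad}δ_{bc})` (`BlockClosedForm.trace_gamma_three/four`);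
hence the trace of `(a₀ + Σ u_κγ_κ)(v₀ + v₁γ_ν)(a₀' + Σ u'_κγ_κ)(w₀ + w₁γ_μ)` (`trace_four`) and its real
specialisation (`trace_four_real`, where `i² = −1` is used).  (2) At the block momenta `cos(θ + πn) = (−1)ⁿ cos θ`,
`sin(θ + πn) = (−1)ⁿ sin θ`, so `M_W(P_σ) = A(σ)`, `h(P_σ) = hh(σ)`, `h(P_σ + q) = hh(σ + s)`; for an active
direction the vertices collapse to `V_μ(P,q) = −i cos P_μ − sin P_μ γ_μ`, `V_ν(P+q,q) = i cos P_ν + sin P_ν γ_ν`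
(`vertex_active`, `vertex_active_shift`).  (3) Per block momentum the real part of the bubble trace is
`2T/(hh hh')` (`bubble_re`), the tadpole term is `2(S2_μ − A sg C_μ)/hh`; sum over `σ`.

Sources.  Montvay–Münster, *Quantum Fields on a Lattice* §4.2 and App. 8.1.2 (Wilson fermions in momentum space,
Euclidean `γ`-matrices); folklore `γ`-matrix trace identities.  Pure theorem file (no `def`s); pattern: sibling
`…StubBlockHessianFormulaAuxB` (`trace_symbolInv_mul_hop`).
-/
noncomputable section

open scoped BigOperators Classical Matrix ComplexConjugate
open Finset
open Literature.MathematicalPhysics.QuantumLattice Literature.MathematicalPhysics.QuantumFieldTheory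
  Literature.Probability.LatticeModels

namespace Summit.QuantumFields.QCD.Cruxes.CriticalLineDiamagnetism.ChessboardCellGain

open Complex (I)
open Summit.QuantumFields.QCD.Cruxes.WilsonQuarkStability.FreeTangentLandauChessboard

namespace BlockClosedForm

/-! ### Spin traces of three and four gamma matrices -/

/-- The trace of a product of three gamma matrices vanishes (it is `γ₅`-odd). -/
theorem trace_gamma_three (a b c : Fin 4) :
    (euclideanGamma a * euclideanGamma b * euclideanGamma c).trace = 0 := by
  -- conjugation by `γ₅` fixes the trace and negates `X = γ_a γ_b γ_c`
  suffices key : ∀ X : Matrix (Fin 4) (Fin 4) ℂ, gammaFive * X * gammaFive = -X → X.trace = 0 by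
    refine key _ ?_
    calc gammaFive * (euclideanGamma a * euclideanGamma b * euclideanGamma c) * gammaFive
        = (gammaFive * euclideanGamma a) * euclideanGamma b * euclideanGamma c * gammaFive := by noncomm_ring
      _ = -(euclideanGamma a * (gammaFive * euclideanGamma b) * euclideanGamma c * gammaFive) := by
          rw [gammaFive_mul_euclideanGamma a]; noncomm_ring
      _ = euclideanGamma a * euclideanGamma b * (gammaFive * euclideanGamma c) * gammaFive := by
          rw [gammaFive_mul_euclideanGamma b]; noncomm_ring
      _ = -(euclideanGamma a * euclideanGamma b * euclideanGamma c * (gammaFive * gammaFive)) := by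
          rw [gammaFive_mul_euclideanGamma c]; noncomm_ring
      _ = -(euclideanGamma a * euclideanGamma b * euclideanGamma c) := by rw [gammaFive_mul_self, Matrix.mul_one]
  intro X hX
  have ht : X.trace = -X.trace := by
    conv_lhs => rw [← Matrix.mul_one X, ← gammaFive_mul_self, ← Matrix.mul_assoc, Matrix.trace_mul_comm,
      ← Matrix.mul_assoc, hX, Matrix.trace_neg]
  linear_combination ht / 2

/-- `tr (γ_a γ_b γ_c γ_d) = 4(δ_{ab}δ_{cd} − δ_{ac}δ_{bd} + δ_{ad}δ_{bc})` (from the Clifford relations). -/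
theorem trace_gamma_four (a b c d : Fin 4) :
    (euclideanGamma a * euclideanGamma b * euclideanGamma c * euclideanGamma d).trace =
      4 * ((if a = b then 1 else 0) * (if c = d then 1 else 0) -
        (if a = c then 1 else 0) * (if b = d then 1 else 0) +
        (if a = d then 1 else 0) * (if b = c then 1 else 0)) := by
  -- Clifford relations `γ_x γ_y = 2δ_{xy} − γ_y γ_x` and `tr γ_x γ_y = 4δ_{xy}`
  have hcl : ∀ x y : Fin 4, euclideanGamma x * euclideanGamma y =
      (2 * (if x = y then (1 : ℂ) else 0)) • (1 : Matrix (Fin 4) (Fin 4) ℂ) - euclideanGamma y * euclideanGamma x := by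
    intro x y
    have h := euclideanGamma_anticomm_holds x y
    rw [eq_sub_iff_add_eq, h]
    split_ifs
    · rw [mul_one, two_smul]; exact one_add_one_eq_two.symm
    · rw [mul_zero, zero_smul]
  have t2 : ∀ x y : Fin 4, (euclideanGamma x * euclideanGamma y).trace = 4 * (if x = y then 1 else 0) :=
    fun x y => by rw [trace_euclideanGamma_mul]; split_ifs <;> norm_num
  -- move `γ_a` to the right in three steps, then use cyclicity
  have e1 : (euclideanGamma a * euclideanGamma b * euclideanGamma c * euclideanGamma d).trace =
      2 * (if a = b then 1 else 0) * (euclideanGamma c * euclideanGamma d).trace -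
        (euclideanGamma b * euclideanGamma a * euclideanGamma c * euclideanGamma d).trace := by
    rw [hcl a b]
    simp only [Matrix.sub_mul, Matrix.smul_mul, Matrix.one_mul, Matrix.trace_sub, Matrix.trace_smul,
      smul_eq_mul, mul_assoc]
  have e2 : (euclideanGamma b * euclideanGamma a * euclideanGamma c * euclideanGamma d).trace =
      2 * (if a = c then 1 else 0) * (euclideanGamma b * euclideanGamma d).trace -
        (euclideanGamma b * euclideanGamma c * euclideanGamma a * euclideanGamma d).trace := by
    rw [Matrix.mul_assoc (euclideanGamma b) (euclideanGamma a) (euclideanGamma c), hcl a c]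
    simp only [Matrix.mul_sub, Matrix.sub_mul, Matrix.mul_smul, Matrix.mul_one, Matrix.smul_mul,
      Matrix.trace_sub, Matrix.trace_smul, smul_eq_mul, mul_assoc]
  have e3 : (euclideanGamma b * euclideanGamma c * euclideanGamma a * euclideanGamma d).trace =
      2 * (if a = d then 1 else 0) * (euclideanGamma b * euclideanGamma c).trace -
        (euclideanGamma a * euclideanGamma b * euclideanGamma c * euclideanGamma d).trace := by
    rw [Matrix.mul_assoc (euclideanGamma b * euclideanGamma c) (euclideanGamma a) (euclideanGamma d), hcl a d,
      Matrix.mul_sub, Matrix.mul_smul, Matrix.mul_one, Matrix.trace_sub, Matrix.trace_smul, smul_eq_mul,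
      ← Matrix.mul_assoc (euclideanGamma b * euclideanGamma c) (euclideanGamma d) (euclideanGamma a),
      Matrix.trace_mul_comm (euclideanGamma b * euclideanGamma c * euclideanGamma d) (euclideanGamma a),
      ← Matrix.mul_assoc (euclideanGamma a) (euclideanGamma b * euclideanGamma c) (euclideanGamma d),
      ← Matrix.mul_assoc (euclideanGamma a) (euclideanGamma b) (euclideanGamma c)]
  rw [t2] at e1 e2 e3
  linear_combination (e1 - e2 + e3) / 2

/-- `Σ_{κκ'} u_κ u'_{κ'} tr (γ_κ γ_x γ_{κ'} γ_y) = 4 (u_x u'_y − δ_{xy} Σ_κ u_κ u'_κ + u_y u'_x)`. -/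
theorem sum_sum_four (u u' : Fin 4 → ℂ) (x y : Fin 4) :
    ∑ κ, ∑ κ', u κ * (u' κ' * (euclideanGamma κ * euclideanGamma x * euclideanGamma κ' * euclideanGamma y).trace) =
      4 * (u x * u' y - (if x = y then 1 else 0) * (∑ κ, u κ * u' κ) + u y * u' x) := by
  have e : ∀ κ κ', u κ * (u' κ' * (euclideanGamma κ * euclideanGamma x * euclideanGamma κ' * euclideanGamma y).trace) =
      4 * ((if κ = x then u κ else 0) * (if κ' = y then u' κ' else 0)) -
        4 * ((if x = y then 1 else 0) * (if κ = κ' then u κ * u' κ' else 0)) +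
        4 * ((if κ = y then u κ else 0) * (if x = κ' then u' κ' else 0)) := by
    intro κ κ'
    rw [trace_gamma_four]
    split_ifs <;> ring
  simp_rw [e]
  simp only [Finset.sum_add_distrib, Finset.sum_sub_distrib, ← Finset.mul_sum, ← Finset.sum_mul,
    Finset.sum_ite_eq', Finset.sum_ite_eq, Finset.mem_univ, if_true]
  ring

/-! ### The four-factor trace -/

/-- The trace of `(a₀ + Σ u_κγ_κ)(v₀ + v₁γ_ν)(a₀' + Σ u'_κγ_κ)(w₀ + w₁γ_μ)`. -/
theorem trace_four (a₀ a₀' v₀ v₁ w₀ w₁ : ℂ) (u u' : Fin 4 → ℂ) (μ ν : Fin 4) :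
    ((a₀ • (1 : Matrix (Fin 4) (Fin 4) ℂ) + ∑ κ, u κ • euclideanGamma κ) *
        (v₀ • (1 : Matrix (Fin 4) (Fin 4) ℂ) + v₁ • euclideanGamma ν) *
        (a₀' • (1 : Matrix (Fin 4) (Fin 4) ℂ) + ∑ κ, u' κ • euclideanGamma κ) *
        (w₀ • (1 : Matrix (Fin 4) (Fin 4) ℂ) + w₁ • euclideanGamma μ)).trace =
      4 * (a₀ * a₀' * (v₀ * w₀ + (if μ = ν then 1 else 0) * (v₁ * w₁)) +
        a₀ * (v₀ * w₁ * u' μ + v₁ * w₀ * u' ν) + a₀' * (v₀ * w₁ * u μ + v₁ * w₀ * u ν) +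
        (v₀ * w₀ - (if μ = ν then 1 else 0) * (v₁ * w₁)) * ∑ κ, u κ * u' κ +
        v₁ * w₁ * (u ν * u' μ + u μ * u' ν)) := by
  set U : Matrix (Fin 4) (Fin 4) ℂ := ∑ κ, u κ • euclideanGamma κ with hU
  set U' : Matrix (Fin 4) (Fin 4) ℂ := ∑ κ, u' κ • euclideanGamma κ with hU'
  have t1 : ∀ x : Fin 4, (euclideanGamma x).trace = 0 := trace_euclideanGamma'
  have t2 : ∀ x y : Fin 4, (euclideanGamma x * euclideanGamma y).trace = 4 * (if x = y then 1 else 0) := fun x y => by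
    rw [trace_euclideanGamma_mul]; split_ifs <;> norm_num
  have f1 : U.trace = 0 := by simp [hU, Matrix.trace_sum, Matrix.trace_smul, t1]
  have f1' : U'.trace = 0 := by simp [hU', Matrix.trace_sum, Matrix.trace_smul, t1]
  have f2 : ∀ x, (U * euclideanGamma x).trace = 4 * u x := fun x => by
    simp only [hU, Finset.sum_mul, Matrix.smul_mul, Matrix.trace_sum, Matrix.trace_smul, t2, smul_eq_mul,
      mul_ite, mul_one, mul_zero, Finset.sum_ite_eq', Finset.mem_univ, if_true]
    ring
  have f2' : ∀ x, (U' * euclideanGamma x).trace = 4 * u' x := fun x => by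
    simp only [hU', Finset.sum_mul, Matrix.smul_mul, Matrix.trace_sum, Matrix.trace_smul, t2, smul_eq_mul,
      mul_ite, mul_one, mul_zero, Finset.sum_ite_eq', Finset.mem_univ, if_true]
    ring
  have f3' : ∀ x, (euclideanGamma x * U').trace = 4 * u' x := fun x => by rw [Matrix.trace_mul_comm]; exact f2' x
  have f4 : (U * U').trace = 4 * ∑ κ, u κ * u' κ := by
    rw [hU, hU', Finset.sum_mul, Matrix.trace_sum, Finset.mul_sum]
    refine Finset.sum_congr rfl fun κ _ => ?_
    rw [Finset.mul_sum, Matrix.trace_sum]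
    simp only [Matrix.smul_mul, Matrix.mul_smul, Matrix.trace_smul, t2, smul_eq_mul, mul_ite, mul_one,
      mul_zero, Finset.sum_ite_eq, Finset.mem_univ, if_true]
    ring
  have f5 : ∀ x y, (euclideanGamma x * U' * euclideanGamma y).trace = 0 := fun x y => by
    rw [hU', Finset.mul_sum, Finset.sum_mul, Matrix.trace_sum]
    refine Finset.sum_eq_zero fun κ _ => ?_
    rw [Matrix.mul_smul, Matrix.smul_mul, Matrix.trace_smul, trace_gamma_three, smul_zero]
  have f6 : ∀ x, (U * U' * euclideanGamma x).trace = 0 := fun x => by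
    rw [hU, hU', Finset.sum_mul, Finset.sum_mul, Matrix.trace_sum]
    refine Finset.sum_eq_zero fun κ _ => ?_
    rw [Finset.mul_sum, Finset.sum_mul, Matrix.trace_sum]
    refine Finset.sum_eq_zero fun κ' _ => ?_
    rw [Matrix.smul_mul, Matrix.mul_smul, Matrix.smul_mul, Matrix.smul_mul, Matrix.trace_smul, Matrix.trace_smul,
      trace_gamma_three, smul_zero, smul_zero]
  have f7 : ∀ x y, (U * euclideanGamma x * euclideanGamma y).trace = 0 := fun x y => by
    rw [hU, Finset.sum_mul, Finset.sum_mul, Matrix.trace_sum]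
    refine Finset.sum_eq_zero fun κ _ => ?_
    rw [Matrix.smul_mul, Matrix.smul_mul, Matrix.trace_smul, trace_gamma_three, smul_zero]
  have f8 : ∀ x, (U * euclideanGamma x * U').trace = 0 := fun x => by
    rw [hU, hU', Finset.sum_mul, Finset.sum_mul, Matrix.trace_sum]
    refine Finset.sum_eq_zero fun κ _ => ?_
    rw [Finset.mul_sum, Matrix.trace_sum]
    refine Finset.sum_eq_zero fun κ' _ => ?_
    rw [Matrix.smul_mul, Matrix.smul_mul, Matrix.mul_smul, Matrix.trace_smul, Matrix.trace_smul,
      trace_gamma_three, smul_zero, smul_zero]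
  have f9 : ∀ x y, (U * euclideanGamma x * U' * euclideanGamma y).trace =
      4 * (u x * u' y - (if x = y then 1 else 0) * (∑ κ, u κ * u' κ) + u y * u' x) := fun x y => by
    rw [← sum_sum_four u u' x y, hU, hU', Finset.sum_mul, Finset.sum_mul, Finset.sum_mul, Matrix.trace_sum]
    refine Finset.sum_congr rfl fun κ _ => ?_
    rw [Finset.mul_sum, Finset.sum_mul, Matrix.trace_sum]
    refine Finset.sum_congr rfl fun κ' _ => ?_
    rw [Matrix.smul_mul, Matrix.smul_mul, Matrix.mul_smul, Matrix.smul_mul, Matrix.smul_mul,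
      Matrix.trace_smul, Matrix.trace_smul, smul_eq_mul, smul_eq_mul]
  simp only [Matrix.add_mul, Matrix.mul_add, Matrix.smul_mul, Matrix.mul_smul, Matrix.one_mul,
    Matrix.mul_one, Matrix.trace_add, Matrix.trace_smul, Matrix.trace_one, Fintype.card_fin, smul_eq_mul,
    t1, t2, f1, f1', f2, f2', f3', f4, f5, f6, f7, f8, f9]
  by_cases hμν : μ = ν
  · subst hμν; simp only [if_true]; push_cast; ring
  · simp only [hμν, Ne.symm hμν, if_false]; push_cast; ring

/-- Pulling a scalar through the symbol `A·1 − iΣ_κ t_κγ_κ`. -/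
theorem smul_symbol (r A : ℂ) (t : Fin 4 → ℂ) :
    r • (A • (1 : Matrix (Fin 4) (Fin 4) ℂ) - I • ∑ κ, t κ • euclideanGamma κ) =
      (r * A) • (1 : Matrix (Fin 4) (Fin 4) ℂ) + ∑ κ, (-(r * (I * t κ))) • euclideanGamma κ := by
  rw [smul_sub, smul_smul, smul_smul, Finset.smul_sum, sub_eq_add_neg, ← Finset.sum_neg_distrib]
  congr 1
  refine Finset.sum_congr rfl fun κ _ => ?_
  rw [smul_smul, ← neg_smul, mul_assoc]

/-- `Σ_κ (−r i t_κ)(−r' i t'_κ) = −r r' Σ_κ t_κ t'_κ` for real `t, t'`. -/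
theorem sum_neg_mul_neg (r r' : ℂ) (t t' : Fin 4 → ℝ) :
    ∑ κ, -(r * (I * (t κ : ℂ))) * -(r' * (I * (t' κ : ℂ))) = -(r * r') * ∑ κ, ((t κ * t' κ : ℝ) : ℂ) := by
  rw [Finset.mul_sum]
  refine Finset.sum_congr rfl fun κ _ => ?_
  push_cast
  linear_combination (r * r' * (t κ : ℂ) * (t' κ : ℂ)) * Complex.I_mul_I

/-- **The bubble spin trace, real form**: for real data,
`tr ((A − iΣ t_κγ_κ)/g · (i x + p γ_ν) · (A' − iΣ t'_κγ_κ)/g' · (−i y − m γ_μ))` is an explicit real number. -/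
theorem trace_four_real (g g' A A' x y p m : ℝ) (t t' : Fin 4 → ℝ) (μ ν : Fin 4) :
    ((((g : ℂ))⁻¹ • (((A : ℝ) : ℂ) • (1 : Matrix (Fin 4) (Fin 4) ℂ) - I • ∑ κ, ((t κ : ℝ) : ℂ) • euclideanGamma κ)) *
        ((I * ((x : ℝ) : ℂ)) • (1 : Matrix (Fin 4) (Fin 4) ℂ) + ((p : ℝ) : ℂ) • euclideanGamma ν) *
        (((g' : ℂ))⁻¹ • (((A' : ℝ) : ℂ) • (1 : Matrix (Fin 4) (Fin 4) ℂ) - I • ∑ κ, ((t' κ : ℝ) : ℂ) • euclideanGamma κ)) *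
        ((-(I * ((y : ℝ) : ℂ))) • (1 : Matrix (Fin 4) (Fin 4) ℂ) + (-((m : ℝ) : ℂ)) • euclideanGamma μ)).trace =
      ((4 * (g⁻¹ * g'⁻¹) *
          (A * A' * (x * y - (if μ = ν then 1 else 0) * (p * m)) + A * (-(x * m * t' μ) - p * y * t' ν) +
            A' * (-(x * m * t μ) - p * y * t ν) -
            (x * y + (if μ = ν then 1 else 0) * (p * m)) * ∑ κ, t κ * t' κ +
            p * m * (t ν * t' μ + t μ * t' ν)) : ℝ) : ℂ) := by
  rw [smul_symbol, smul_symbol, trace_four, sum_neg_mul_neg]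
  split_ifs <;> push_cast <;> linear_combination (4 * ((g : ℂ))⁻¹ * ((g' : ℂ))⁻¹ *
    (-((A : ℂ) * A' * x * y) + A * (x * m * (t' μ) + p * y * (t' ν)) +
      A' * (x * m * (t μ) + p * y * (t ν)) + x * y * (∑ κ, ((t κ : ℂ) * (t' κ : ℂ))) -
      p * m * ((t ν : ℂ) * (t' μ) + (t μ) * (t' ν)))) * Complex.I_mul_I

/-! ### Vertices and block momenta -/

/-- An active forward vertex: `−½ e^{ix} i (1 − γ_μ) − ½ e^{−i(x+π)} (−i)(1 + γ_μ) = −i cos x − sin x γ_μ`. -/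
theorem vertex_active (x : ℝ) (μ : Fin 4) :
    (-(1 / 2 : ℂ) * (Complex.exp (↑x * I) * I)) • ((1 : Matrix (Fin 4) (Fin 4) ℂ) - euclideanGamma μ) +
        (-(1 / 2 : ℂ) * (Complex.exp (-(↑(x + Real.pi) * I)) * (-I))) •
          ((1 : Matrix (Fin 4) (Fin 4) ℂ) + euclideanGamma μ) =
      (-(I * ((Real.cos x : ℝ) : ℂ))) • (1 : Matrix (Fin 4) (Fin 4) ℂ) + (-((Real.sin x : ℝ) : ℂ)) • euclideanGamma μ := by
  have h1 : Complex.exp (↑x * I) = ↑(Real.cos x) + ↑(Real.sin x) * I := by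
    rw [Complex.exp_mul_I, ← Complex.ofReal_cos, ← Complex.ofReal_sin]
  have h2 : Complex.exp (-(↑(x + Real.pi) * I)) = -(↑(Real.cos x) - ↑(Real.sin x) * I) := by
    rw [Complex.ofReal_add,
      show -(((x : ℂ) + (Real.pi : ℂ)) * I) = (-(x : ℂ)) * I - (Real.pi : ℂ) * I by ring,
      Complex.exp_sub, Complex.exp_pi_mul_I, Complex.exp_mul_I, Complex.cos_neg, Complex.sin_neg,
      ← Complex.ofReal_cos, ← Complex.ofReal_sin]
    ring
  rw [h1, h2]
  ext i j
  simp only [Matrix.add_apply, Matrix.smul_apply, Matrix.sub_apply, Matrix.one_apply, smul_eq_mul]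
  split_ifs <;> linear_combination (euclideanGamma μ i j * ↑(Real.sin x)) * Complex.I_mul_I

/-- An active vertex at the shifted momentum:
`−½ e^{i(x+π)} i (1 − γ_ν) − ½ e^{−i(x+2π)} (−i)(1 + γ_ν) = i cos x + sin x γ_ν`. -/
theorem vertex_active_shift (x : ℝ) (ν : Fin 4) :
    (-(1 / 2 : ℂ) * (Complex.exp (↑(x + Real.pi) * I) * I)) • ((1 : Matrix (Fin 4) (Fin 4) ℂ) - euclideanGamma ν) +
        (-(1 / 2 : ℂ) * (Complex.exp (-(↑(x + Real.pi + Real.pi) * I)) * (-I))) •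
          ((1 : Matrix (Fin 4) (Fin 4) ℂ) + euclideanGamma ν) =
      (I * ((Real.cos x : ℝ) : ℂ)) • (1 : Matrix (Fin 4) (Fin 4) ℂ) + ((Real.sin x : ℝ) : ℂ) • euclideanGamma ν := by
  have h1 : Complex.exp (↑x * I) = ↑(Real.cos x) + ↑(Real.sin x) * I := by
    rw [Complex.exp_mul_I, ← Complex.ofReal_cos, ← Complex.ofReal_sin]
  have h3 : Complex.exp (↑(x + Real.pi) * I) = -(↑(Real.cos x) + ↑(Real.sin x) * I) := by
    rw [Complex.ofReal_add, add_mul, Complex.exp_add, Complex.exp_pi_mul_I, h1]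
    ring
  have h4 : Complex.exp (-(↑(x + Real.pi + Real.pi) * I)) = ↑(Real.cos x) - ↑(Real.sin x) * I := by
    rw [Complex.ofReal_add, Complex.ofReal_add,
      show -(((x : ℂ) + (Real.pi : ℂ) + (Real.pi : ℂ)) * I) = (-(x : ℂ)) * I - 2 * (Real.pi : ℂ) * I by ring,
      Complex.exp_sub, Complex.exp_two_pi_mul_I, div_one, Complex.exp_mul_I, Complex.cos_neg,
      Complex.sin_neg, ← Complex.ofReal_cos, ← Complex.ofReal_sin]
    ring
  rw [h3, h4]
  ext i j
  simp only [Matrix.add_apply, Matrix.smul_apply, Matrix.sub_apply, Matrix.one_apply, smul_eq_mul]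
  split_ifs <;> linear_combination (-(euclideanGamma ν i j * ↑(Real.sin x))) * Complex.I_mul_I

/-- Signs on `(ℤ/2)`: `(−1)^{val(a+b)} = (−1)^{val a} (−1)^{val b}`. -/
theorem neg_one_pow_val_add (a b : ZMod 2) : (-1 : ℝ) ^ (a + b).val = (-1) ^ a.val * (-1) ^ b.val := by
  obtain ⟨n, hn⟩ : ∃ n : ℕ, a.val + b.val = (a + b).val + 2 * n :=
    ⟨(a.val + b.val) / 2, by rw [ZMod.val_add]; omega⟩
  rw [← pow_add, hn, pow_add, pow_mul, neg_one_sq, one_pow, mul_one]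

/-! ### The bubble term per block momentum -/

/-- **The bubble term in real closed form.**  With `a_κ = sin P_κ`, `c_κ = cos P_κ`, the sign vector
`τ = (−1)^s` (`τ_μ = τ_ν = −1` for active `μ, ν`) and `q_κ = a_κ²`:
`½ Re tr (S(P) V_ν(P+q,q) S(P+q) V_μ(P,q)) = 2T/(g g')` with the quartic `T` of the statement. -/
theorem bubble_re (A A' g g' : ℝ) (a c q τ : Fin 4 → ℝ) (μ ν : Fin 4) (hμ : τ μ = -1) (hν : τ ν = -1)
    (hq : ∀ κ, a κ ^ 2 = q κ) :
    (1 / 2 : ℝ) * ((((g : ℂ))⁻¹ • (((A : ℝ) : ℂ) • (1 : Matrix (Fin 4) (Fin 4) ℂ) -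
          I • ∑ κ, ((a κ : ℝ) : ℂ) • euclideanGamma κ)) *
        ((I * ((c ν : ℝ) : ℂ)) • (1 : Matrix (Fin 4) (Fin 4) ℂ) + ((a ν : ℝ) : ℂ) • euclideanGamma ν) *
        (((g' : ℂ))⁻¹ • (((A' : ℝ) : ℂ) • (1 : Matrix (Fin 4) (Fin 4) ℂ) -
          I • ∑ κ, ((τ κ * a κ : ℝ) : ℂ) • euclideanGamma κ)) *
        ((-(I * ((c μ : ℝ) : ℂ))) • (1 : Matrix (Fin 4) (Fin 4) ℂ) + (-((a μ : ℝ) : ℂ)) • euclideanGamma μ)).trace.re =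
      2 * (A * A' * c μ * c ν - (∑ κ, τ κ * q κ) * c μ * c ν + (A - A') * (c μ * q ν + c ν * q μ) -
        2 * q μ * q ν + (if μ = ν then (-(A * A') - ∑ κ, τ κ * q κ) * q μ else 0)) / (g * g') := by
  rw [trace_four_real, Complex.ofReal_re]
  have hW : ∑ κ, a κ * (τ κ * a κ) = ∑ κ, τ κ * q κ :=
    Finset.sum_congr rfl fun κ _ => by rw [← hq]; ring
  rw [hW, hμ, hν]
  by_cases hμν : μ = ν
  · subst hμν; simp only [if_true, ← hq]; ring
  · simp only [hμν, if_false, ← hq]; ring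

end BlockClosedForm

/-- **CF — the real closed form of the block-Hessian entries** (stub `stub_blockClosedForm` of crux
stmt-QuantumFields-9734, line `Sketch`).  For active directions `μ, ν` (`s_μ = s_ν = 1`) the momentum-form
block Hessian `H_s(μ,ν)` of `stub_blockHessianFormula` (mass `0`) equals the explicit rational function
`Hc_s(μ,ν)` of `cos θ_κ`: `[μ=ν] Σ_σ 2(S2_μ − A(σ) sg_σ(μ) C_μ)/hh(σ) + Σ_σ 2T(σ,s,μ,ν)/(hh(σ)hh(σ+s))`. -/
theorem stub_blockClosedForm : ∀ (θ : Fin 4 → ℝ), (∀ μ, 0 < θ μ ∧ θ μ < Real.pi) → let Mw : (Fin 4 → ℝ) → ℝ := fun P => (0 : ℝ) + ∑ κ : Fin 4, (1 - Real.cos (P κ)); let h : (Fin 4 → ℝ) → ℝ := fun P => Mw P ^ 2 + ∑ κ : Fin 4, Real.sin (P κ) ^ 2; let S : (Fin 4 → ℝ) → Matrix (Fin 4) (Fin 4) ℂ := fun P => ((h P)⁻¹ : ℂ) • (((Mw P : ℝ) : ℂ) • (1 : Matrix (Fin 4) (Fin 4) ℂ) - Complex.I • ∑ κ : Fin 4,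 ((Real.sin (P κ) : ℝ) : ℂ) • euclideanGamma κ); let V : (Fin 4 → ℝ) → (Fin 4 → ℝ) → Fin 4 → Matrix (Fin 4) (Fin 4) ℂ := fun P q μ => (-(1 / 2 : ℂ) * (Complex.exp (↑(P μ) * Complex.I) * Complex.I)) • ((1 : Matrix (Fin 4) (Fin 4) ℂ) - euclideanGamma μ) + (-(1 / 2 : ℂ) * (Complex.exp (-(↑(P μ + q μ) * Complex.I)) * (-Complex.I))) • ((1 : Matrix (Fin 4) (Fin 4) ℂ) + euclideanGamma μ); let mom : (Fin 4 → ZMod 2) → (Fin 4 → ℝ) := fun s κ => θ κ + Real.pi * ((s κ).val : ℝ); let qv : (Fin 4 → ZMod 2) → (Fin 4 → ℝ) := fun s κ => Real.pi * ((s κ).val : ℝ); let H : (Fin 4 → ZMod 2) → Fin 4 → Fin 4 → ℝ := fun s μ ν => (if μ = ν then (1 / 2 : ℝ) * ∑ s' : Fin 4 → ZMod 2, 4 * (Real.sin (mom s' μ) ^ 2 - Mw (mom s') * Real.cos (mom s' μ)) / h (mom s') else 0) + (1 / 2 : ℝ) * (∑ s' : Fin 4 → ZMod 2, (S (mom s')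 * V (mom s' + qv s) (qv s) ν * S (mom s' + qv s) * V (mom s') (qv s) μ).trace).re; let C : Fin 4 → ℝ := fun κ => Real.cos (θ κ); let S2 : Fin 4 → ℝ := fun κ => 1 - C κ ^ 2; let sg : (Fin 4 → ZMod 2) → Fin 4 → ℝ := fun t κ => (-1 : ℝ) ^ (t κ).val; let A : (Fin 4 → ZMod 2) → ℝ := fun σ => ∑ κ : Fin 4, (1 - sg σ κ * C κ); let hh : (Fin 4 → ZMod 2) → ℝ := fun σ => A σ ^ 2 + ∑ κ : Fin 4, S2 κ; let W : (Fin 4 → ZMod 2) → ℝ := fun s => ∑ κ : Fin 4, sg s κ * S2 κ; let T : (Fin 4 → ZMod 2) → (Fin 4 → ZMod 2) → Fin 4 → Fin 4 → ℝ := fun σ s μ ν => A σ * A (σ + s) * (sg σ μ * C μ) * (sg σ ν * C ν) - W s * (sg σ μ * C μ) * (sg σ ν * C ν) + (A σ - A (σ + s)) * (sg σ μ * C μ * S2 ν + sg σ ν * C ν * S2 μ) - 2 * S2 μ * S2 ν + (if μ = ν then (-(A σ * A (σ + s)) - W s) * S2 μ else 0); let Hc : (Fin 4 → ZMod 2) →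 Fin 4 → Fin 4 → ℝ := fun s μ ν => (if μ = ν then ∑ σ : Fin 4 → ZMod 2, 2 * (S2 μ - A σ * (sg σ μ * C μ)) / hh σ else 0) + ∑ σ : Fin 4 → ZMod 2, 2 * T σ s μ ν / (hh σ * hh (σ + s)); ∀ (s : Fin 4 → ZMod 2) (μ ν : Fin 4), s μ = 1 → s ν = 1 → H s μ ν = Hc s μ ν := by
  intro θ _ Mw h S V mom qv H C S2 sg A hh W T Hc s μ ν hsμ hsν
  have hv1 : ((1 : ZMod 2).val : ℕ) = 1 := rfl
  have hq : ∀ κ, s κ = 1 → qv s κ = Real.pi := fun κ hκ => by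
    show Real.pi * (((s κ).val : ℕ) : ℝ) = Real.pi
    rw [hκ, hv1, Nat.cast_one, mul_one]
  have hτ : ∀ κ, s κ = 1 → sg s κ = -1 := fun κ hκ => by
    show (-1 : ℝ) ^ (s κ).val = -1
    rw [hκ, hv1, pow_one]
  have sg_sq : ∀ t κ, sg t κ ^ 2 = 1 := fun t κ => by
    show ((-1 : ℝ) ^ (t κ).val) ^ 2 = 1
    rw [← pow_mul, mul_comm, pow_mul, neg_one_sq, one_pow]
  have hcos : ∀ σ κ, Real.cos (mom σ κ) = sg σ κ * C κ := fun σ κ => by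
    show Real.cos (θ κ + Real.pi * (((σ κ).val : ℕ) : ℝ)) = (-1 : ℝ) ^ (σ κ).val * Real.cos (θ κ)
    rw [mul_comm Real.pi, Real.cos_add_nat_mul_pi]
  have hsin : ∀ σ κ, Real.sin (mom σ κ) = sg σ κ * Real.sin (θ κ) := fun σ κ => by
    show Real.sin (θ κ + Real.pi * (((σ κ).val : ℕ) : ℝ)) = (-1 : ℝ) ^ (σ κ).val * Real.sin (θ κ)
    rw [mul_comm Real.pi, Real.sin_add_nat_mul_pi]
  have hcos' : ∀ σ κ, Real.cos ((mom σ + qv s) κ) = sg s κ * (sg σ κ * C κ) := fun σ κ => by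
    show Real.cos (θ κ + Real.pi * (((σ κ).val : ℕ) : ℝ) + Real.pi * (((s κ).val : ℕ) : ℝ)) =
      (-1 : ℝ) ^ (s κ).val * ((-1 : ℝ) ^ (σ κ).val * Real.cos (θ κ))
    rw [mul_comm Real.pi (((s κ).val : ℕ) : ℝ), Real.cos_add_nat_mul_pi, mul_comm Real.pi, Real.cos_add_nat_mul_pi]
  have hsin' : ∀ σ κ, Real.sin ((mom σ + qv s) κ) = sg s κ * (sg σ κ * Real.sin (θ κ)) := fun σ κ => by
    show Real.sin (θ κ + Real.pi * (((σ κ).val : ℕ) : ℝ) + Real.pi * (((s κ).val : ℕ) : ℝ)) =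
      (-1 : ℝ) ^ (s κ).val * ((-1 : ℝ) ^ (σ κ).val * Real.sin (θ κ))
    rw [mul_comm Real.pi (((s κ).val : ℕ) : ℝ), Real.sin_add_nat_mul_pi, mul_comm Real.pi, Real.sin_add_nat_mul_pi]
  have hsg_add : ∀ σ κ, sg (σ + s) κ = sg σ κ * sg s κ := fun σ κ => by
    show (-1 : ℝ) ^ (σ κ + s κ).val = (-1 : ℝ) ^ (σ κ).val * (-1 : ℝ) ^ (s κ).val
    exact BlockClosedForm.neg_one_pow_val_add _ _
  have hMw : ∀ σ, Mw (mom σ) = A σ := fun σ => by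
    show (0 : ℝ) + ∑ κ, (1 - Real.cos (mom σ κ)) = ∑ κ, (1 - sg σ κ * C κ)
    rw [zero_add]; exact Finset.sum_congr rfl fun κ _ => by rw [hcos]
  have hMw' : ∀ σ, Mw (mom σ + qv s) = A (σ + s) := fun σ => by
    show (0 : ℝ) + ∑ κ, (1 - Real.cos ((mom σ + qv s) κ)) = ∑ κ, (1 - sg (σ + s) κ * C κ)
    rw [zero_add]; exact Finset.sum_congr rfl fun κ _ => by rw [hcos', hsg_add]; ring
  have hS2 : ∀ σ κ, (sg σ κ * Real.sin (θ κ)) ^ 2 = S2 κ := fun σ κ => by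
    show (sg σ κ * Real.sin (θ κ)) ^ 2 = 1 - Real.cos (θ κ) ^ 2
    rw [mul_pow, sg_sq, one_mul, Real.sin_sq]
  have hh1 : ∀ σ, h (mom σ) = hh σ := fun σ => by
    show Mw (mom σ) ^ 2 + ∑ κ, Real.sin (mom σ κ) ^ 2 = A σ ^ 2 + ∑ κ, S2 κ
    rw [hMw]; congr 1; exact Finset.sum_congr rfl fun κ _ => by rw [hsin, hS2]
  have hh2 : ∀ σ, h (mom σ + qv s) = hh (σ + s) := fun σ => by
    show Mw (mom σ + qv s) ^ 2 + ∑ κ, Real.sin ((mom σ + qv s) κ) ^ 2 = A (σ + s) ^ 2 + ∑ κ, S2 κ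
    rw [hMw']; congr 1; exact Finset.sum_congr rfl fun κ _ => by rw [hsin', mul_pow, sg_sq, one_mul, hS2]
  have hSσ : ∀ σ, S (mom σ) = ((hh σ : ℂ))⁻¹ • (((A σ : ℝ) : ℂ) • (1 : Matrix (Fin 4) (Fin 4) ℂ) -
      I • ∑ κ, ((sg σ κ * Real.sin (θ κ) : ℝ) : ℂ) • euclideanGamma κ) := fun σ => by
    show ((h (mom σ) : ℂ))⁻¹ • (((Mw (mom σ) : ℝ) : ℂ) • (1 : Matrix (Fin 4) (Fin 4) ℂ) -
      I • ∑ κ, ((Real.sin (mom σ κ) : ℝ) : ℂ) • euclideanGamma κ) = _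
    rw [hh1, hMw]; simp only [hsin]
  have hSσ' : ∀ σ, S (mom σ + qv s) = ((hh (σ + s) : ℂ))⁻¹ • (((A (σ + s) : ℝ) : ℂ) •
      (1 : Matrix (Fin 4) (Fin 4) ℂ) -
      I • ∑ κ, ((sg s κ * (sg σ κ * Real.sin (θ κ)) : ℝ) : ℂ) • euclideanGamma κ) := fun σ => by
    show ((h (mom σ + qv s) : ℂ))⁻¹ • (((Mw (mom σ + qv s) : ℝ) : ℂ) • (1 : Matrix (Fin 4) (Fin 4) ℂ) -
      I • ∑ κ, ((Real.sin ((mom σ + qv s) κ) : ℝ) : ℂ) • euclideanGamma κ) = _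
    rw [hh2, hMw']; simp only [hsin']
  have hVμ : ∀ σ, V (mom σ) (qv s) μ = (-(I * ((sg σ μ * C μ : ℝ) : ℂ))) • (1 : Matrix (Fin 4) (Fin 4) ℂ) +
      (-((sg σ μ * Real.sin (θ μ) : ℝ) : ℂ)) • euclideanGamma μ := fun σ => by
    show (-(1 / 2 : ℂ) * (Complex.exp (↑(mom σ μ) * I) * I)) • ((1 : Matrix (Fin 4) (Fin 4) ℂ) - euclideanGamma μ) +
      (-(1 / 2 : ℂ) * (Complex.exp (-(↑(mom σ μ + qv s μ) * I)) * (-I))) •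
        ((1 : Matrix (Fin 4) (Fin 4) ℂ) + euclideanGamma μ) = _
    rw [hq μ hsμ, BlockClosedForm.vertex_active, hcos, hsin]
  have hVν : ∀ σ, V (mom σ + qv s) (qv s) ν = (I * ((sg σ ν * C ν : ℝ) : ℂ)) • (1 : Matrix (Fin 4) (Fin 4) ℂ) +
      ((sg σ ν * Real.sin (θ ν) : ℝ) : ℂ) • euclideanGamma ν := fun σ => by
    show (-(1 / 2 : ℂ) * (Complex.exp (↑(mom σ ν + qv s ν) * I) * I)) •
        ((1 : Matrix (Fin 4) (Fin 4) ℂ) - euclideanGamma ν) +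
      (-(1 / 2 : ℂ) * (Complex.exp (-(↑(mom σ ν + qv s ν + qv s ν) * I)) * (-I))) •
        ((1 : Matrix (Fin 4) (Fin 4) ℂ) + euclideanGamma ν) = _
    rw [hq ν hsν, BlockClosedForm.vertex_active_shift, hcos, hsin]
  -- assemble: unfold `H`, `Hc` and compare term by term in `σ`
  simp only [H, Hc]
  congr 1
  · split_ifs with hμν
    · rw [Finset.mul_sum]
      refine Finset.sum_congr rfl fun σ _ => ?_
      rw [hsin, hS2, hMw, hcos, hh1]
      ring
    · rfl
  · rw [Complex.re_sum, Finset.mul_sum]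
    refine Finset.sum_congr rfl fun σ _ => ?_
    rw [hSσ, hSσ', hVμ, hVν]
    exact BlockClosedForm.bubble_re (A σ) (A (σ + s)) (hh σ) (hh (σ + s)) (fun κ => sg σ κ * Real.sin (θ κ))
      (fun κ => sg σ κ * C κ) S2 (sg s) μ ν (hτ μ hsμ) (hτ ν hsν) (fun κ => hS2 σ κ)

end Summit.QuantumFields.QCD.Cruxes.CriticalLineDiamagnetism.ChessboardCellGain
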